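import Literature.Barriers.CriticalPhenomena.LaceExpansionIsingGreenComparisonSymbols
import Literature.Barriers.CriticalPhenomena.LaceExpansionIsingDeconvolutionProp12FourierRep
import Literature.Barriers.CriticalPhenomena.LaceExpansionIsingDeconvolutionProp12Lem31
import Mathlib.Analysis.Calculus.BumpFunction.FiniteDimension
import Mathlib.Analysis.SpecialFunctions.Pow.Real
import HarnessLib

/-!
# Liu–Slade 2026, Lemma 5.1 for pure derivatives (`LiuSlade2026_lem51_L1_holds`) and
# Proposition 1.2 (1.9) (`LiuSlade2026_prop12_asymp_holds`)

Barrier catalogue `Literature/Barriers/CriticalPhenomena/` (D-0021). DISCHARGES the named fact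
`SpreadOutIsing.LiuSlade2026_lem51_L1` of `LaceExpansionIsingDeconvolutionProp12.lean` — Liu–Slade
2026, Lemma 5.1 (5.5) in the classical pure-derivative form: for `d > 2`, `ε > 0` there are `C`,
`L₀` with `∫_{[-π,π]^d} |∂_j^m φ̂| ≤ C/L^{1-ε}` for all `L ≥ L₀`, axes `j`, `m ≤ d - 1`, where
`φ̂ = 1/(1 - D̂) - 1 - σ^{-2}(ε/d)^{-1}` (`soPhiHat`) — and with it, through the proved assembly
`LiuSlade2026_prop12_asymp_of_parts` and the discharged `LiuSlade2026_prop12_fourierRep_holds`,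
`LiuSlade2026_lem31_fiber_holds`, **Proposition 1.2, (1.9)**: `LiuSlade2026_prop12_asymp_holds`.

## The proof of Lemma 5.1 (classical, pointwise; all `L`-dependence explicit)

The source bounds `‖φ̂_α‖_1` by Hölder's inequality from `L^q` bounds on the factors of
`φ̂ = D̂f̂ - σ^{-2}Ĉ_1F̂`, `f̂ = Ê/(ÂF̂)` (Lemma 5.2, Lemma 3.6). Here the derivatives are bounded
POINTWISE on `[-π,π]^d ∖ {0}` and integrated against three explicit majorants; no `L^p` theory and
no weak derivatives are used. With `F = 1 - D̂`, `A = 1 - D̂_nn = ε/d`, `λ = σ^{-2}`,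
`E = A - λF` (whose zeroth and second moments vanish: `Σ_y D(y)(k·y)² = σ²|k|²/d`), along the fibre
`t ↦ k[j ↦ t]` through a point `k` off the `j`-axis one has `φ̂ = F⁻¹ - 1 - λA⁻¹ = E·A⁻¹·F⁻¹ - 1`,
and with `ρ = ‖k‖_∞`, `n = d - 1`:

* on the small ball `Lρ ≤ 1`: `A ≥ (2/π²d)ρ²`, `|A^{(i)}| ≤ π^n ρ^{2-i}`; `F ≥ L²ρ²/16`,
  `|F^{(i)}| ≤ dL²ρ^{2-i}`; `|E^{(i)}| ≤ 10d³L²ρ^{4-i}` (the matched Taylor bounds of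
  `LaceExpansionIsingGreenComparisonSymbols.lean`); so by the product and reciprocal rules of
  `LaceExpansionSymbolCalculus.lean` `|∂_j^m φ̂| ≤ C_B ρ^{-m} + 1`, and
  `∫_{Lρ≤1} (C_B ρ^{-(d-1)} + 1) ≲ 1/L`;
* off the small ball: `F ≥ 1/16`, `|F^{(i)}| ≤ 4L^i M_L(k)` (the Dirichlet-kernel bound of
  `LaceExpansionIsingGreenComparisonSymbols.lean`, Part 2), so `|∂^m F⁻¹| ≤ K L^m M_L(k)` with
  `∫ M_L ≤ ((2π/L)(1 + log L))^d`; and `λ|∂^m A⁻¹| ≤ λK_A ρ^{-2-m} ≤ λK_Aπ^d ρ^{-(d+1)}` with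
  `∫_{ρ ≥ 1/L} ρ^{-(d+1)} ≲ L`, `λ ≤ 3/(dL²)`; for `m = 0`, `|φ̂| ≤ 16|D̂| + λd π²/(2ρ²)` with
  `|D̂| ≤ 2M_L + 1/N_L`;
* altogether `∫_{[-π,π]^d} |∂_j^m φ̂| ≤ K_d (1 + log L)^d / L ≤ K_d (1 + d/ε)^d / L^{1-ε}`.

Measurability of `∂_j^m φ̂` (`soPhiHatD`, an `iteratedDeriv` along fibres) comes from the bridge
`∂_j^m φ̂(k) = D^mφ̂(k)(e_j,…,e_j)` (`iteratedDeriv_slice_eq_iteratedFDeriv_of_contDiffOn`, a local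
version through a bump function) and the joint smoothness of `φ̂` off `(2πℤ)^d`.

## References

Section and equation numbers are those of the arXiv version held in the literature store (its §5,
Lemmas 5.1–5.2, is Appendix A, Lemmas A.1–A.2, of the journal version).

* Y. Liu, G. Slade, *Gaussian deconvolution and the lace expansion for spread-out models*,
  Ann. Inst. H. Poincaré Probab. Statist. 62 (2026), arXiv:2310.07640: Prop. 1.2 (1.9); §5:
  (5.2)–(5.4), Lemma 5.1 (5.5), Lemma 5.2 and their proofs; Lemma 3.6 [LiuSlade2026].
-/

noncomputable section

/-! ## A local bridge: slice derivatives are directional derivatives -/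

namespace Literature.Barriers.CriticalPhenomena

open Filter Metric
open scoped Topology

variable {d : ℕ} {𝔽 : Type*} [NormedAddCommGroup 𝔽] [NormedSpace ℝ 𝔽]

/-- `k[l ↦ s] = k[l ↦ 0] + s e_l`. [folklore] -/
theorem update_eq_update_zero_add_smul (k : Fin d → ℝ) (l : Fin d) (s : ℝ) :
    Function.update k l s = Function.update k l 0 + s • (Pi.single l (1 : ℝ) : Fin d → ℝ) := by
  ext i
  by_cases hi : i = l
  · subst hi; simp
  · simp [Function.update_of_ne hi, Pi.single_eq_of_ne hi]

/-- **Global bridge**: for `Φ ∈ C^N(ℝ^d)` and `j ≤ N`, the `j`-th derivative of the slice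
`s ↦ Φ(k[l ↦ s])` is the directional derivative `D^jΦ(k[l↦s])(e_l,…,e_l)` (for `𝔽 = ℂ` the left
side at `s = k_l` is the tree's `sliceDeriv Φ l j k`, `LaceExpansionHaraLemma41.lean`, by `rfl`).
[folklore] -/
theorem iteratedDeriv_slice_eq_iteratedFDeriv {Φ : (Fin d → ℝ) → 𝔽} {N : WithTop ℕ∞}
    (hΦ : ContDiff ℝ N Φ) {j : ℕ} (hj : (j : WithTop ℕ∞) ≤ N) (k : Fin d → ℝ) (l : Fin d) (s : ℝ) :
    iteratedDeriv j (fun t : ℝ => Φ (Function.update k l t)) s =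
      iteratedFDeriv ℝ j Φ (Function.update k l s) fun _ => Pi.single l 1 := by
  set e : Fin d → ℝ := Pi.single l 1 with he
  set k₀ : Fin d → ℝ := Function.update k l 0 with hk₀
  set ι : ℝ →L[ℝ] (Fin d → ℝ) := ContinuousLinearMap.toSpanSingleton ℝ e with hι
  set Ψ : (Fin d → ℝ) → 𝔽 := fun v => Φ (k₀ + v) with hΨ
  have hΨc : ContDiff ℝ N Ψ := hΦ.comp (contDiff_const.add contDiff_id)
  have hfun : (fun t : ℝ => Φ (Function.update k l t)) = Ψ ∘ ι := by
    funext t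
    simp only [Function.comp_apply, hΨ, hι, ContinuousLinearMap.toSpanSingleton_apply, hk₀, he]
    rw [update_eq_update_zero_add_smul]
  rw [hfun, iteratedDeriv_eq_iteratedFDeriv, ι.iteratedFDeriv_comp_right hΨc s hj,
    ContinuousMultilinearMap.compContinuousLinearMap_apply]
  have hΨd : iteratedFDeriv ℝ j Ψ (ι s) = iteratedFDeriv ℝ j Φ (k₀ + ι s) := by
    rw [hΨ, iteratedFDeriv_comp_add_left]
  have hpt : k₀ + ι s = Function.update k l s := by
    simp only [hι, ContinuousLinearMap.toSpanSingleton_apply, hk₀, he]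
    rw [← update_eq_update_zero_add_smul]
  rw [hΨd, hpt]
  congr 1
  funext i
  simp [hι, he]

/-- **Local bridge**: if `Φ` is `C^N` on an open set `U ∋ k`, then for `j ≤ N` the `j`-th derivative
at `t = k_l` of the slice `t ↦ Φ(k[l ↦ t])` is `D^jΦ(k)(e_l,…,e_l)` (localisation of the global
bridge by a smooth bump function). [folklore] -/
theorem iteratedDeriv_slice_eq_iteratedFDeriv_of_contDiffOn {Φ : (Fin d → ℝ) → 𝔽} {N : ℕ∞}
    {U : Set (Fin d → ℝ)} (hU : IsOpen U) (hΦ : ContDiffOn ℝ N Φ U) {j : ℕ}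
    (hj : (j : ℕ∞) ≤ N) {k : Fin d → ℝ} (hk : k ∈ U) (l : Fin d) :
    iteratedDeriv j (fun t : ℝ => Φ (Function.update k l t)) (k l) =
      iteratedFDeriv ℝ j Φ k fun _ => Pi.single l 1 := by
  -- a bump function supported in `U`, equal to `1` near `k`
  obtain ⟨r, hr, hrU⟩ := Metric.isOpen_iff.1 hU k hk
  let χ : ContDiffBump k := ⟨r / 4, r / 2, by positivity, by linarith⟩
  set Ψ : (Fin d → ℝ) → 𝔽 := fun x => χ x • Φ x with hΨ
  have hsupp : tsupport (χ : (Fin d → ℝ) → ℝ) ⊆ U := by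
    rw [χ.tsupport_eq]
    exact (Metric.closedBall_subset_ball (by show r / 2 < r; linarith)).trans hrU
  have hΨc : ContDiff ℝ N Ψ := by
    rw [contDiff_iff_contDiffAt]
    intro x
    by_cases hx : x ∈ U
    · exact ((χ.contDiff (n := N)).contDiffAt).smul (hΦ.contDiffAt (hU.mem_nhds hx))
    · have hχ : (χ : (Fin d → ℝ) → ℝ) =ᶠ[𝓝 x] 0 :=
        notMem_tsupport_iff_eventuallyEq.1 fun h => hx (hsupp h)
      have hΨ0 : Ψ =ᶠ[𝓝 x] fun _ => 0 := by
        filter_upwards [hχ] with y hy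
        simp [hΨ, hy]
      exact (contDiffAt_const (c := (0 : 𝔽))).congr_of_eventuallyEq hΨ0
  have hΨΦ : Ψ =ᶠ[𝓝 k] Φ := by
    filter_upwards [χ.eventuallyEq_one] with y hy
    simp [hΨ, hy]
  -- the slices agree near `t = k l`
  have hslice : (fun t : ℝ => Φ (Function.update k l t)) =ᶠ[𝓝 (k l)]
      fun t : ℝ => Ψ (Function.update k l t) := by
    have hcont : Continuous fun t : ℝ => Function.update k l t :=
      continuous_const.update l continuous_id
    have ht : Tendsto (fun t : ℝ => Function.update k l t) (𝓝 (k l)) (𝓝 k) := by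
      simpa using hcont.tendsto (k l)
    filter_upwards [ht.eventually hΨΦ] with t hts
    exact hts.symm
  have hj' : (j : WithTop ℕ∞) ≤ (N : WithTop ℕ∞) := by exact_mod_cast hj
  rw [hslice.iteratedDeriv_eq j, iteratedDeriv_slice_eq_iteratedFDeriv hΨc hj' k l (k l),
    Function.update_eq_self]
  exact congrFun (congrArg DFunLike.coe ((hΨΦ.iteratedFDeriv ℝ j).eq_of_nhds)) _

/-- Directional derivatives of a function `C^N` on an open set are continuous there:
`k ↦ D^jΦ(k)(v,…,v)` is continuous on `U` (`j ≤ N`). [folklore] -/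
theorem continuousOn_iteratedFDeriv_apply_of_contDiffOn {Φ : (Fin d → ℝ) → 𝔽} {N : ℕ∞}
    {U : Set (Fin d → ℝ)} (hU : IsOpen U) (hΦ : ContDiffOn ℝ N Φ U) {j : ℕ}
    (hj : (j : ℕ∞) ≤ N) (v : Fin j → Fin d → ℝ) :
    ContinuousOn (fun k => iteratedFDeriv ℝ j Φ k v) U := by
  have hj' : (j : WithTop ℕ∞) ≤ (N : WithTop ℕ∞) := by exact_mod_cast hj
  have h1 : ContinuousOn (iteratedFDerivWithin ℝ j Φ U) U :=
    hΦ.continuousOn_iteratedFDerivWithin hj' hU.uniqueDiffOn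
  have h2 : ContinuousOn (fun k => iteratedFDerivWithin ℝ j Φ U k v) U :=
    (ContinuousMultilinearMap.apply ℝ (fun _ : Fin j => Fin d → ℝ) 𝔽 v).continuous.comp_continuousOn h1
  refine h2.congr fun k hk => ?_
  simp only
  rw [iteratedFDerivWithin_of_isOpen j hU hk]

end Literature.Barriers.CriticalPhenomena

namespace Literature.Barriers.CriticalPhenomena.SpreadOutIsing

open _root_.MeasureTheory Filter _root_.Topology Finset Literature.Probability.LatticeModels Set
open scoped BigOperators Real

variable {d L : ℕ}

/-! ## The smooth domain of `φ̂` and the measurability of `∂_j^m φ̂` -/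

/-- The open set `{1 - D̂ ≠ 0, ε ≠ 0} = ℝ^d ∖ (2πℤ)^d` on which `φ̂` is smooth. [folklore] -/
def soPhiHatDom (d L : ℕ) : Set (Fin d → ℝ) := {k | 1 - soSymbol d L k ≠ 0 ∧ dispersion k ≠ 0}

/-- `ε` is smooth. [folklore] -/
theorem contDiff_dispersion {n : WithTop ℕ∞} : ContDiff ℝ n (dispersion : (Fin d → ℝ) → ℝ) := by
  unfold dispersion
  exact ContDiff.sum fun i _ => contDiff_const.sub (Real.contDiff_cos.comp (contDiff_apply ℝ ℝ i))

/-- The smooth domain is open. [folklore] -/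
theorem isOpen_soPhiHatDom : IsOpen (soPhiHatDom d L) :=
  (isOpen_ne_fun (continuous_const.sub continuous_soSymbol) continuous_const).inter
    (isOpen_ne_fun (continuous_dispersion d) continuous_const)

/-- The punctured cube lies in the smooth domain (`d, L ≥ 1`). [folklore] -/
theorem mem_soPhiHatDom (hd : 1 ≤ d) (hL : 1 ≤ L) {k : Fin d → ℝ} (hk : k ∈ cube d) (hk0 : k ≠ 0) :
    k ∈ soPhiHatDom d L :=
  ⟨(sub_pos.2 (soSymbol_lt_one hd hL hk hk0)).ne', (dispersion_pos_of_mem_brillouin hk hk0).ne'⟩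

/-- `φ̂` is smooth on its domain. [cite: LiuSlade2026, §5 (φ̂ = D̂f̂ - σ^{-2}Ĉ_1F̂ off k = 0)] -/
theorem contDiffOn_soPhiHat (hd : 1 ≤ d) {n : WithTop ℕ∞} :
    ContDiffOn ℝ n (soPhiHat d L) (soPhiHatDom d L) := by
  have hd0 : (d : ℝ) ≠ 0 := by exact_mod_cast (by omega : d ≠ 0)
  unfold soPhiHat
  refine ((ContDiffOn.inv ?_ fun _ hk => hk.1).sub contDiffOn_const).sub
    (contDiffOn_const.mul (ContDiffOn.inv ?_ fun _ hk => ?_))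
  · exact (contDiff_const.sub contDiff_soSymbol).contDiffOn
  · exact (contDiff_dispersion.div_const _).contDiffOn
  · exact div_ne_zero hk.2 hd0

/-- **Bridge**: on the smooth domain, `∂_j^m φ̂(k) = D^mφ̂(k)(e_j,…,e_j)`. [folklore] -/
theorem soPhiHatD_eq_iteratedFDeriv (hd : 1 ≤ d) {k : Fin d → ℝ} (hk : k ∈ soPhiHatDom d L)
    (j : Fin d) (m : ℕ) :
    soPhiHatD d L j m k = iteratedFDeriv ℝ m (soPhiHat d L) k fun _ => Pi.single j 1 :=
  iteratedDeriv_slice_eq_iteratedFDeriv_of_contDiffOn (N := (⊤ : ℕ∞)) isOpen_soPhiHatDom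
    (contDiffOn_soPhiHat hd) le_top hk j

/-- `∂_j^m φ̂` is continuous on the smooth domain. [folklore] -/
theorem continuousOn_soPhiHatD (hd : 1 ≤ d) (j : Fin d) (m : ℕ) :
    ContinuousOn (soPhiHatD d L j m) (soPhiHatDom d L) :=
  (continuousOn_iteratedFDeriv_apply_of_contDiffOn (N := (⊤ : ℕ∞)) isOpen_soPhiHatDom
    (contDiffOn_soPhiHat (L := L) hd) le_top fun _ => Pi.single j 1).congr
      fun _ hk => soPhiHatD_eq_iteratedFDeriv hd hk j m

/-- `∂_j^m φ̂` is a.e.-strongly measurable on the cube (`d, L ≥ 1`). [folklore] -/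
theorem aestronglyMeasurable_soPhiHatD (hd : 1 ≤ d) (hL : 1 ≤ L) (j : Fin d) (m : ℕ) :
    AEStronglyMeasurable (soPhiHatD d L j m) (volume.restrict (cube d)) := by
  have hmeas : MeasurableSet (cube d ∩ soPhiHatDom d L) :=
    (measurableSet_brillouin d).inter isOpen_soPhiHatDom.measurableSet
  have h1 : AEStronglyMeasurable (soPhiHatD d L j m) (volume.restrict (cube d ∩ soPhiHatDom d L)) :=
    ((continuousOn_soPhiHatD hd j m).mono Set.inter_subset_right).aestronglyMeasurable hmeas
  have hae : (cube d : Set (Fin d → ℝ)) =ᵐ[volume] (cube d ∩ soPhiHatDom d L : Set (Fin d → ℝ)) := by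
    refine (ae_eq_set).2 ⟨?_, ?_⟩
    · have hsub : cube d \ (cube d ∩ soPhiHatDom d L) ⊆ cube d ∩ {k | k = 0} := by
        intro k hk
        refine ⟨hk.1, ?_⟩
        by_contra h0
        exact hk.2 ⟨hk.1, mem_soPhiHatDom hd hL hk.1 h0⟩
      have h := ae_ne_zero_restrict_cube (d := d) hd
      rw [ae_iff, Measure.restrict_apply' (show MeasurableSet (cube d) from measurableSet_brillouin d)]
        at h
      have hsub' : cube d ∩ {k : Fin d → ℝ | k = 0} ⊆ {a : Fin d → ℝ | ¬a ≠ 0} ∩ cube d :=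
        fun k hk => ⟨by simpa using hk.2, hk.1⟩
      exact measure_mono_null (hsub.trans hsub') h
    · exact measure_mono_null (fun k hk => absurd hk.1.1 hk.2) measure_empty
  rw [Measure.restrict_congr_set hae]
  exact h1

/-! ## Elementary power bookkeeping -/

/-- `L^{m+2} ≤ L² ρ^{-m}` when `Lρ ≤ 1`. [folklore] -/
theorem pow_add_two_le_sq_mul_zpow {Λ ρ : ℝ} (hΛ : 0 ≤ Λ) (hρ : 0 < ρ) (h : Λ * ρ ≤ 1) (m : ℕ) :
    Λ ^ (m + 2) ≤ Λ ^ 2 * ρ ^ (-(m : ℤ)) := by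
  have hΛρ : Λ ≤ ρ⁻¹ := by rw [← one_div, le_div_iff₀ hρ]; exact h
  calc Λ ^ (m + 2) = Λ ^ 2 * Λ ^ m := by ring
    _ ≤ Λ ^ 2 * (ρ⁻¹) ^ m := by gcongr
    _ = Λ ^ 2 * ρ ^ (-(m : ℤ)) := by rw [zpow_neg, zpow_natCast, inv_pow]

/-- `1 ≤ R^n ρ^{-m}` when `0 < ρ ≤ R`, `1 ≤ R`, `m ≤ n`. [folklore] -/
theorem one_le_pow_mul_zpow_neg {R ρ : ℝ} (hρ : 0 < ρ) (hρR : ρ ≤ R) (hR : 1 ≤ R) {m n : ℕ} (hmn : m ≤ n) :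
    1 ≤ R ^ n * ρ ^ (-(m : ℤ)) := by
  have hR0 : 0 < R := lt_of_lt_of_le one_pos hR
  have h1 : R ^ m * ρ ^ (-(m : ℤ)) ≥ 1 := by
    rw [zpow_neg, zpow_natCast, ge_iff_le, ← div_eq_mul_inv, one_le_div (pow_pos hρ m)]
    exact pow_le_pow_left₀ hρ.le hρR m
  calc (1 : ℝ) ≤ R ^ m * ρ ^ (-(m : ℤ)) := h1
    _ ≤ R ^ n * ρ ^ (-(m : ℤ)) :=
        mul_le_mul_of_nonneg_right (pow_le_pow_right₀ hR hmn) (zpow_nonneg hρ.le _)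

/-- `σ⁻² ≤ 3/(dL²)` (`d, L ≥ 1`). [cite: LiuSlade2026, §5 (σ^{-2} ≲ L^{-2})] -/
theorem inv_soVariance_le (hd : 1 ≤ d) (hL : 1 ≤ L) : (soVariance d L)⁻¹ ≤ 3 / (d * (L : ℝ) ^ 2) := by
  have h := soVariance_ge (d := d) hd hL
  have hpos : 0 < (d : ℝ) / 3 * (L : ℝ) ^ 2 := by
    have : (0 : ℝ) < d := by exact_mod_cast (by omega : 0 < d)
    positivity
  calc (soVariance d L)⁻¹ ≤ ((d : ℝ) / 3 * (L : ℝ) ^ 2)⁻¹ := inv_anti₀ hpos h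
    _ = 3 / (d * (L : ℝ) ^ 2) := by rw [div_mul_eq_mul_div, inv_div]

/-! ## The fibres of `φ̂` and their building blocks -/

/-- Along every fibre, `φ̂ = F⁻¹ - 1 - σ^{-2}A⁻¹` with `F = 1 - D̂`, `A = 1 - D̂_nn = ε/d`.
[cite: LiuSlade2026, (5.2)–(5.4) (φ̂ = 1/F̂ - 1 - 1/(σ²Â))] -/
theorem soPhiHat_eq_inv_sub (hd : 1 ≤ d) (k : Fin d → ℝ) :
    soPhiHat d L k = (1 - soSymbol d L k)⁻¹ - 1 - (soVariance d L)⁻¹ * (1 - nnSymbol k)⁻¹ := by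
  rw [soPhiHat, one_sub_nnSymbol hd]

/-- **The nearest-neighbour factor `A = 1 - D̂_nn` along a fibre**: smooth, positive off the
`j`-axis, `A(k) ≥ (2/(π²d))‖k‖²_∞`, and `|A^{(i)}(k)| ≤ π^n ‖k‖^{2-i}_∞` (`1 ≤ i ≤ n`), on `[-π,π]^d`.
[cite: LiuSlade2026, Lemma 5.2 (the bound on Â_γ/Â: "Taylor expansion and the explicit, L-independent formula")] -/
theorem nnFactor_bounds (hd : 1 ≤ d) {k : Fin d → ℝ} (hk : k ∈ cube d) {j : Fin d}
    (hk0 : Function.update k j 0 ≠ 0) (n : ℕ) :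
    (ContDiff ℝ n fun t : ℝ => 1 - nnSymbol (Function.update k j t)) ∧
    (∀ t, 1 - nnSymbol (Function.update k j t) ≠ 0) ∧
    2 / (π ^ 2 * d) * ‖k‖ ^ (2 : ℤ) ≤ |1 - nnSymbol k| ∧
    ∀ i, 1 ≤ i → i ≤ n →
      |iteratedDeriv i (fun t : ℝ => 1 - nnSymbol (Function.update k j t)) (k j)| ≤
        π ^ n * ‖k‖ ^ ((2 : ℤ) - i) := by
  have hd0 : (0 : ℝ) < d := by exact_mod_cast (by omega : 0 < d)
  have hk1 : k ≠ 0 := fun h => hk0 (by rw [h]; simp)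
  have hρ : 0 < ‖k‖ := norm_pos_iff.2 hk1
  have hρπ : ‖k‖ ≤ π := by
    refine (pi_norm_le_iff_of_nonneg Real.pi_pos.le).2 fun i => ?_
    have := hk i (Set.mem_univ _)
    rw [Real.norm_eq_abs]; exact abs_le.2 ⟨this.1, this.2⟩
  refine ⟨contDiff_const.sub (contDiff_nnSymbol_slice k j), fun t => ?_, ?_, ?_⟩
  · rw [one_sub_nnSymbol hd]
    exact (div_pos (dispersion_update_pos hk hk0 t) hd0).ne'
  · rw [one_sub_nnSymbol hd, abs_of_nonneg (div_nonneg (dispersion_nonneg k) hd0.le),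
      show ‖k‖ ^ (2 : ℤ) = ‖k‖ ^ 2 from zpow_ofNat ‖k‖ 2]
    have h := mul_norm_sq_le_dispersion (d := d) hk
    calc 2 / (π ^ 2 * d) * ‖k‖ ^ 2 = (2 / π ^ 2 * ‖k‖ ^ 2) / d := by field_simp
      _ ≤ dispersion k / d := div_le_div_of_nonneg_right h hd0.le
  · intro i hi1 hin
    rw [iteratedDeriv_const_sub (by omega), iteratedDeriv_neg, iteratedDeriv_nnSymbol_slice hi1, abs_neg,
      abs_div, abs_of_pos hd0]
    have hcos : |Real.cos (k j + i * (π / 2))| / d ≤ |Real.cos (k j + i * (π / 2))| :=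
      div_le_self (abs_nonneg _) (by exact_mod_cast hd)
    refine hcos.trans ?_
    rcases Nat.lt_or_ge i 2 with hlt | hge
    · obtain rfl : i = 1 := by omega
      rw [Nat.cast_one, one_mul, Real.cos_add_pi_div_two, abs_neg,
        show (2 : ℤ) - (1 : ℕ) = 1 by norm_num, zpow_one]
      calc |Real.sin (k j)| ≤ |k j| := Real.abs_sin_le_abs
        _ ≤ ‖k‖ := abs_apply_le_norm k j
        _ ≤ π ^ n * ‖k‖ := le_mul_of_one_le_left hρ.le (one_le_pow₀ (by linarith [Real.pi_gt_three]))
    · obtain ⟨m, rfl⟩ : ∃ m, i = m + 2 := ⟨i - 2, by omega⟩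
      rw [show (2 : ℤ) - (m + 2 : ℕ) = -(m : ℤ) by push_cast; ring]
      calc |Real.cos (k j + ((m + 2 : ℕ) : ℝ) * (π / 2))| ≤ 1 := Real.abs_cos_le_one _
        _ ≤ π ^ n * ‖k‖ ^ (-(m : ℤ)) :=
            one_le_pow_mul_zpow_neg hρ hρπ (by linarith [Real.pi_gt_three]) (by omega)

/-- **The spread-out factor `F = 1 - D̂` along a fibre, on the small ball `L‖k‖_∞ ≤ 1`**: smooth,
positive off the `j`-axis, `F(k) ≥ L²‖k‖²/16` (infrared bound), and `|F^{(i)}(k)| ≤ dL²‖k‖^{2-i}`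
(`1 ≤ i ≤ n`). [cite: LiuSlade2026, Lemma 5.2 with Lemma 3.6 (F̂ ≳ L²|k|² ∧ 1; F̂_γ/F̂)] -/
theorem soFactor_bounds_ball (hd : 1 ≤ d) (hL : 1 ≤ L) {k : Fin d → ℝ} (hk : k ∈ cube d) {j : Fin d}
    (hk0 : Function.update k j 0 ≠ 0) (hball : (L : ℝ) * ‖k‖ ≤ 1) (n : ℕ) :
    (ContDiff ℝ n fun t : ℝ => 1 - soSymbol d L (Function.update k j t)) ∧
    (∀ t, 1 - soSymbol d L (Function.update k j t) ≠ 0) ∧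
    1 / 16 * (L : ℝ) ^ 2 * ‖k‖ ^ (2 : ℤ) ≤ |1 - soSymbol d L k| ∧
    ∀ i, 1 ≤ i → i ≤ n →
      |iteratedDeriv i (fun t : ℝ => 1 - soSymbol d L (Function.update k j t)) (k j)| ≤
        d * (L : ℝ) ^ 2 * ‖k‖ ^ ((2 : ℤ) - i) := by
  have hk1 : k ≠ 0 := fun h => hk0 (by rw [h]; simp)
  have hρ : 0 < ‖k‖ := norm_pos_iff.2 hk1
  have hL0 : (0 : ℝ) < L := by exact_mod_cast (by omega : 0 < L)
  refine ⟨contDiff_const.sub (contDiff_soSymbol_slice k j), fun t => (one_sub_soSymbol_update_pos hd hL hk hk0 t).ne',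
    ?_, ?_⟩
  · have h := infrared_lower_bound hd hL hk
    have hmin : min ((L : ℝ) ^ 2 * ‖k‖ ^ 2) 1 = (L : ℝ) ^ 2 * ‖k‖ ^ 2 :=
      min_eq_left (by rw [← mul_pow]; exact pow_le_one₀ (by positivity) hball)
    rw [hmin] at h
    rw [abs_of_pos (sub_pos.2 (soSymbol_lt_one hd hL hk hk1)), zpow_two, ← pow_two]
    linarith
  · intro i hi1 hin
    rw [iteratedDeriv_const_sub (by omega), iteratedDeriv_neg, iteratedDeriv_soSymbol_slice,
      Function.update_eq_self, abs_neg]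
    rcases Nat.lt_or_ge i 2 with hlt | hge
    · obtain rfl : i = 1 := by omega
      rw [show (2 : ℤ) - (1 : ℕ) = 1 by norm_num, zpow_one]
      exact abs_soSymbolD_one_le hd hL j k
    · obtain ⟨m, rfl⟩ : ∃ m, i = m + 2 := ⟨i - 2, by omega⟩
      rw [show (2 : ℤ) - (m + 2 : ℕ) = -(m : ℤ) by push_cast; ring]
      calc |soSymbolD d L j (m + 2) k| ≤ (L : ℝ) ^ (m + 2) := abs_soSymbolD_le hd hL j _ k
        _ ≤ (L : ℝ) ^ 2 * ‖k‖ ^ (-(m : ℤ)) := pow_add_two_le_sq_mul_zpow hL0.le hρ hball m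
        _ ≤ d * (L : ℝ) ^ 2 * ‖k‖ ^ (-(m : ℤ)) := by
            rw [mul_assoc]
            exact le_mul_of_one_le_left (by positivity) (by exact_mod_cast hd)

/-- **`F = 1 - D̂` along a fibre, off the small ball `L‖k‖_∞ ≥ 1`**: `F(k) ≥ 1/16` and
`|F^{(i)}(k)| ≤ 4 L^i M_L(k)` (`i ≥ 1`), `M_L = dirichletMajorant L`. [cite: LiuSlade2026, Lemma 5.2 with Lemma 3.6 (F̂ ≳ 1 off B_L; ‖D̂_α‖_q ≲ L^{|α|-d/q})] -/
theorem soFactor_bounds_off (hd : 1 ≤ d) (hL : 1 ≤ L) {k : Fin d → ℝ} (hk : k ∈ cube d) (j : Fin d)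
    (hoff : 1 ≤ (L : ℝ) * ‖k‖) (n : ℕ) :
    1 / 16 * ((L : ℝ)⁻¹) ^ (0 : ℤ) ≤ |1 - soSymbol d L k| ∧
    ∀ i, 1 ≤ i → i ≤ n →
      |iteratedDeriv i (fun t : ℝ => 1 - soSymbol d L (Function.update k j t)) (k j)| ≤
        4 * ((L : ℝ)⁻¹) ^ ((0 : ℤ) - i) * dirichletMajorant (L : ℝ) k := by
  have hk1 : k ≠ 0 := by
    rintro rfl
    rw [norm_zero, mul_zero] at hoff; linarith
  refine ⟨?_, fun i hi1 _ => ?_⟩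
  · rw [zpow_zero, mul_one, abs_of_pos (sub_pos.2 (soSymbol_lt_one hd hL hk hk1))]
    exact one_sub_soSymbol_ge_of_le hd hL hk hoff
  · rw [iteratedDeriv_const_sub (by omega), iteratedDeriv_neg, iteratedDeriv_soSymbol_slice,
      Function.update_eq_self, abs_neg, zero_sub, zpow_neg, zpow_natCast, inv_pow, inv_inv]
    exact abs_soSymbolD_le_dirichletMajorant hd hL j hi1 hk

/-- **The matched combination `E = A - σ^{-2}F` along a fibre, on the small ball**: smooth and
`|E^{(i)}(k)| ≤ 10d³L²‖k‖^{4-i}_∞` for all `i ≤ n` (`L‖k‖_∞ ≤ 1`, `d, L ≥ 1`).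
[cite: LiuSlade2026, proof of Lemma 5.2 (the bound on Ê_γ/(ÂF̂) on B_L: |Ê_γ(k)| ≲ L²|k|^{2+τ-|γ|})] -/
theorem eFactor_bounds_ball (hd : 1 ≤ d) (hL : 1 ≤ L) {k : Fin d → ℝ} (hk1 : k ≠ 0) (j : Fin d)
    (hball : (L : ℝ) * ‖k‖ ≤ 1) (n : ℕ) :
    (ContDiff ℝ n fun t : ℝ => eSymbol d L 1 1 (soVariance d L)⁻¹ (Function.update k j t)) ∧
    ∀ i, i ≤ n →
      |iteratedDeriv i (fun t : ℝ => eSymbol d L 1 1 (soVariance d L)⁻¹ (Function.update k j t)) (k j)| ≤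
        10 * (d : ℝ) ^ 3 * (L : ℝ) ^ 2 * ‖k‖ ^ ((4 : ℤ) - i) := by
  have hρ : 0 < ‖k‖ := norm_pos_iff.2 hk1
  have hL0 : (0 : ℝ) < L := by exact_mod_cast (by omega : 0 < L)
  have hL1 : (1 : ℝ) ≤ L := by exact_mod_cast hL
  have hd1 : (1 : ℝ) ≤ d := by exact_mod_cast hd
  have hρ1 : ‖k‖ ≤ 1 := by
    calc ‖k‖ = 1 * ‖k‖ := (one_mul _).symm
      _ ≤ L * ‖k‖ := mul_le_mul_of_nonneg_right hL1 hρ.le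
      _ ≤ 1 := hball
  set lam : ℝ := (soVariance d L)⁻¹ with hlam
  have hσ : 0 < soVariance d L := soVariance_pos hd hL
  have hlam0 : 0 ≤ lam * 1 := by rw [mul_one, hlam]; positivity
  have hlam3 : lam * 1 ≤ 3 / (d * (L : ℝ) ^ 2) := by rw [mul_one, hlam]; exact inv_soVariance_le hd hL
  have hm1 : (1 : ℝ) - 1 = lam * (1 - 1) := by ring
  have hm2 : (1 : ℝ) = lam * 1 * soVariance d L := by rw [hlam, mul_one, inv_mul_cancel₀ hσ.ne']
  refine ⟨contDiff_eSymbol_slice _ _ _ k j, fun i hin => ?_⟩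
  rcases Nat.eq_zero_or_pos i with rfl | hi1
  · rw [iteratedDeriv_zero, Function.update_eq_self, show (4 : ℤ) - (0 : ℕ) = (4 : ℕ) by norm_num,
      zpow_natCast]
    exact abs_eSymbol_le hd hL zero_le_one le_rfl hlam0 hlam3 hm1 hm2 k
  rw [iteratedDeriv_eSymbol_slice hi1, Function.update_eq_self]
  rcases Nat.lt_or_ge i 4 with hlt | hge
  · interval_cases i
    · rw [show (4 : ℤ) - (1 : ℕ) = (3 : ℕ) by norm_num, zpow_natCast]
      calc |eSymbolD d L 1 1 lam j 1 k| ≤ (d : ℝ) ^ 2 * (L : ℝ) ^ 2 * ‖k‖ ^ 3 :=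
            abs_eSymbolD_one_le hd hL zero_le_one le_rfl hlam0 hlam3 hm2 j k
        _ ≤ 10 * (d : ℝ) ^ 3 * (L : ℝ) ^ 2 * ‖k‖ ^ 3 := by
            have : (d : ℝ) ^ 2 ≤ 10 * (d : ℝ) ^ 3 := by nlinarith [one_le_pow₀ (n := 2) hd1]
            have h0 : 0 ≤ (L : ℝ) ^ 2 * ‖k‖ ^ 3 := by positivity
            nlinarith
    · rw [show (4 : ℤ) - (2 : ℕ) = (2 : ℕ) by norm_num, zpow_natCast]
      calc |eSymbolD d L 1 1 lam j 2 k| ≤ 2 * (d : ℝ) * (L : ℝ) ^ 2 * ‖k‖ ^ 2 :=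
            abs_eSymbolD_two_le hd hL zero_le_one le_rfl hlam0 hlam3 hm2 j k
        _ ≤ 10 * (d : ℝ) ^ 3 * (L : ℝ) ^ 2 * ‖k‖ ^ 2 := by
            have : 2 * (d : ℝ) ≤ 10 * (d : ℝ) ^ 3 := by nlinarith [one_le_pow₀ (n := 2) hd1]
            have h0 : 0 ≤ (L : ℝ) ^ 2 * ‖k‖ ^ 2 := by positivity
            nlinarith
    · rw [show (4 : ℤ) - (3 : ℕ) = (1 : ℕ) by norm_num, zpow_natCast, pow_one]
      calc |eSymbolD d L 1 1 lam j 3 k| ≤ 4 * (L : ℝ) ^ 2 * ‖k‖ :=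
            abs_eSymbolD_three_le hd hL zero_le_one le_rfl hlam0 hlam3 j k
        _ ≤ 10 * (d : ℝ) ^ 3 * (L : ℝ) ^ 2 * ‖k‖ := by
            have : (4 : ℝ) ≤ 10 * (d : ℝ) ^ 3 := by nlinarith [one_le_pow₀ (n := 3) hd1]
            have h0 : 0 ≤ (L : ℝ) ^ 2 * ‖k‖ := by positivity
            nlinarith
  · obtain ⟨m, rfl⟩ : ∃ m, i = m + 4 := ⟨i - 4, by omega⟩
    rw [show (4 : ℤ) - (m + 4 : ℕ) = -(m : ℤ) by push_cast; ring]
    have hcrude := abs_eSymbolD_le hd hL zero_le_one le_rfl hlam0 j (m + 4) k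
    -- `1/d + λ L^{m+4} ≤ 10 d³ L² ρ^{-m}`
    have hz1 : 1 ≤ (L : ℝ) ^ 2 * ‖k‖ ^ (-(m : ℤ)) := by
      have h1 : (1 : ℝ) ≤ ‖k‖ ^ (-(m : ℤ)) := by
        rw [zpow_neg, zpow_natCast]
        exact one_le_inv_iff₀.2 ⟨pow_pos hρ m, pow_le_one₀ hρ.le hρ1⟩
      nlinarith [one_le_pow₀ (n := 2) hL1]
    have hz2 : lam * 1 * (L : ℝ) ^ (m + 4) ≤ 3 * ((L : ℝ) ^ 2 * ‖k‖ ^ (-(m : ℤ))) := by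
      have hpow : (L : ℝ) ^ (m + 4) = (L : ℝ) ^ 2 * (L : ℝ) ^ (m + 2) := by ring
      calc lam * 1 * (L : ℝ) ^ (m + 4) ≤ 3 / (d * (L : ℝ) ^ 2) * ((L : ℝ) ^ 2 * (L : ℝ) ^ (m + 2)) := by
            rw [← hpow]; exact mul_le_mul_of_nonneg_right hlam3 (by positivity)
        _ = 3 / d * (L : ℝ) ^ (m + 2) := by field_simp
        _ ≤ 3 * (L : ℝ) ^ (m + 2) := by
            refine mul_le_mul_of_nonneg_right (div_le_self (by norm_num) hd1) (by positivity)
        _ ≤ 3 * ((L : ℝ) ^ 2 * ‖k‖ ^ (-(m : ℤ))) :=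
            mul_le_mul_of_nonneg_left (pow_add_two_le_sq_mul_zpow hL0.le hρ hball m) (by norm_num)
    have hd3 : (1 : ℝ) ≤ (d : ℝ) ^ 3 := one_le_pow₀ hd1
    calc |eSymbolD d L 1 1 lam j (m + 4) k| ≤ 1 / d + lam * 1 * (L : ℝ) ^ (m + 4) := hcrude
      _ ≤ 1 + 3 * ((L : ℝ) ^ 2 * ‖k‖ ^ (-(m : ℤ))) := add_le_add (div_le_self zero_le_one hd1) hz2
      _ ≤ 4 * ((L : ℝ) ^ 2 * ‖k‖ ^ (-(m : ℤ))) := by linarith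
      _ ≤ 10 * (d : ℝ) ^ 3 * (L : ℝ) ^ 2 * ‖k‖ ^ (-(m : ℤ)) := by
          have h0 : 0 ≤ (L : ℝ) ^ 2 * ‖k‖ ^ (-(m : ℤ)) := by positivity
          nlinarith

/-! ## The constants -/

/-- The reciprocal constant of `A⁻¹` (`n` derivatives). [folklore] -/
def lem51KA (n d : ℕ) : ℝ := symInvConst n (π ^ n) (2 / (π ^ 2 * d))

/-- The reciprocal constant of `F⁻¹` on the small ball (`n` derivatives, scale `L²` removed). [folklore] -/
def lem51KF (n d : ℕ) : ℝ := symInvConst n d (1 / 16)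

/-- The reciprocal constant of `F⁻¹` off the small ball. [folklore] -/
def lem51K1 (n : ℕ) : ℝ := symInvConst n 4 (1 / 16)

/-- The constant of `∂^m(E A⁻¹F⁻¹)` on the small ball. [folklore] -/
def lem51CB (n d : ℕ) : ℝ := 4 ^ n * (10 * (d : ℝ) ^ 3) * lem51KA n d * lem51KF n d

/-- `K_A > 0`. [folklore] -/
theorem lem51KA_pos (hd : 1 ≤ d) (n : ℕ) : 0 < lem51KA n d := by
  have : (0 : ℝ) < d := by exact_mod_cast (by omega : 0 < d)
  exact symInvConst_pos n _ (by positivity)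

/-- `K_F > 0`. [folklore] -/
theorem lem51KF_pos (n d : ℕ) : 0 < lem51KF n d := symInvConst_pos n _ (by norm_num)

/-- `K₁ > 0`. [folklore] -/
theorem lem51K1_pos (n : ℕ) : 0 < lem51K1 n := symInvConst_pos n _ (by norm_num)

/-- `C_B > 0`. [folklore] -/
theorem lem51CB_pos (hd : 1 ≤ d) (n : ℕ) : 0 < lem51CB n d := by
  have : (0 : ℝ) < d := by exact_mod_cast (by omega : 0 < d)
  unfold lem51CB
  exact mul_pos (mul_pos (mul_pos (by positivity) (by positivity)) (lem51KA_pos hd n)) (lem51KF_pos n d)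

/-! ## Pointwise bounds on the small ball `L‖k‖_∞ ≤ 1` -/

/-- **On the small ball**: with `ψ = F⁻¹ - σ^{-2}A⁻¹ = E·A⁻¹·F⁻¹` along the fibre through `k`
(`k ∈ [-π,π]^d` off the `j`-axis, `L‖k‖_∞ ≤ 1`, `d, L ≥ 1`), `|ψ^{(i)}(k)| ≤ C_B ‖k‖_∞^{-i}` for all
`i ≤ n` (product and reciprocal rules with the factor bounds above).
[cite: LiuSlade2026, Lemma 5.2 and the proof of Lemma 5.1 (the bound on f̂_α = ∇^α(Ê/(ÂF̂)) on B_L)] -/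
theorem abs_iteratedDeriv_psi_le_ball (hd : 1 ≤ d) (hL : 1 ≤ L) {k : Fin d → ℝ} (hk : k ∈ cube d)
    {j : Fin d} (hk0 : Function.update k j 0 ≠ 0) (hball : (L : ℝ) * ‖k‖ ≤ 1) (n : ℕ) :
    ∀ i, i ≤ n →
      |iteratedDeriv i (fun t : ℝ => (1 - soSymbol d L (Function.update k j t))⁻¹ -
          (soVariance d L)⁻¹ * (1 - nnSymbol (Function.update k j t))⁻¹) (k j)| ≤
        lem51CB n d * ‖k‖ ^ (-(i : ℤ)) := by
  have hk1 : k ≠ 0 := fun h => hk0 (by rw [h]; simp)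
  have hρ : 0 < ‖k‖ := norm_pos_iff.2 hk1
  have hd0 : (0 : ℝ) < d := by exact_mod_cast (by omega : 0 < d)
  have hL0 : (0 : ℝ) < L := by exact_mod_cast (by omega : 0 < L)
  set lam : ℝ := (soVariance d L)⁻¹ with hlam
  set A : ℝ → ℝ := fun t => 1 - nnSymbol (Function.update k j t) with hA
  set F : ℝ → ℝ := fun t => 1 - soSymbol d L (Function.update k j t) with hF
  set E : ℝ → ℝ := fun t => eSymbol d L 1 1 lam (Function.update k j t) with hE
  obtain ⟨hAc, hAne, hAlow, hAder⟩ := nnFactor_bounds hd hk hk0 n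
  obtain ⟨hFc, hFne, hFlow, hFder⟩ := soFactor_bounds_ball hd hL hk hk0 hball n
  obtain ⟨hEc, hEder⟩ := eFactor_bounds_ball hd hL hk1 j hball n
  -- the two reciprocals
  have hAinv := abs_iteratedDeriv_inv_le_of_symbol (f := A) (s := k j) (a := 2) hρ
    (by positivity : (0 : ℝ) < 2 / (π ^ 2 * d)) (by positivity : (0 : ℝ) ≤ π ^ n) hAc hAne
    (by simp only [hA, Function.update_eq_self]; exact hAlow) hAder
  have hFlow' : (L : ℝ) ^ 2 * (1 / 16) * ‖k‖ ^ (2 : ℤ) ≤ |F (k j)| := by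
    simp only [hF, Function.update_eq_self]; linarith [hFlow]
  have hFder' : ∀ i, 1 ≤ i → i ≤ n → |iteratedDeriv i F (k j)| ≤ (L : ℝ) ^ 2 * d * ‖k‖ ^ ((2 : ℤ) - i) :=
    fun i hi1 hin => by rw [mul_comm ((L : ℝ) ^ 2) (d : ℝ)]; exact hFder i hi1 hin
  have hFinv := abs_iteratedDeriv_inv_le_of_symbol (f := F) (s := k j) (a := 2) hρ
    (by positivity : (0 : ℝ) < (L : ℝ) ^ 2 * (1 / 16)) (by positivity : (0 : ℝ) ≤ (L : ℝ) ^ 2 * d) hFc hFne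
    hFlow' hFder'
  rw [symInvConst_mul n (d : ℝ) (by norm_num : (0 : ℝ) < 1 / 16) (by positivity : (0 : ℝ) < (L : ℝ) ^ 2)] at hFinv
  -- `A⁻¹ F⁻¹`
  have hAic : ContDiffAt ℝ n (fun t => (A t)⁻¹) (k j) := (hAc.inv hAne).contDiffAt
  have hFic : ContDiffAt ℝ n (fun t => (F t)⁻¹) (k j) := (hFc.inv hFne).contDiffAt
  have hAF := abs_iteratedDeriv_mul_le_of_symbol hρ hAic hFic hAinv hFinv
  -- `E (A⁻¹ F⁻¹)`
  have hAFc : ContDiffAt ℝ n ((fun t => (A t)⁻¹) * fun t => (F t)⁻¹) (k j) := hAic.mul hFic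
  have hEAF := abs_iteratedDeriv_mul_le_of_symbol hρ hEc.contDiffAt hAFc hEder hAF
  -- the function is `ψ`
  have hfun : (E * ((fun t => (A t)⁻¹) * fun t => (F t)⁻¹)) =
      fun t : ℝ => (1 - soSymbol d L (Function.update k j t))⁻¹ -
        (soVariance d L)⁻¹ * (1 - nnSymbol (Function.update k j t))⁻¹ := by
    funext t
    simp only [Pi.mul_apply, hE, hA, hF, eSymbol, one_mul]
    field_simp [hAne t, hFne t]
    ring
  intro i hin
  have h := hEAF i hin
  rw [hfun] at h
  refine h.trans (le_of_eq ?_)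
  rw [show (4 : ℤ) + (-2 + -2) - i = -(i : ℤ) by ring, lem51CB, lem51KA, lem51KF,
    show (4 : ℝ) ^ n = 2 ^ n * 2 ^ n by rw [← mul_pow]; norm_num]
  field_simp

/-- Along every fibre, `φ̂ = ψ - 1` with `ψ = F⁻¹ - σ^{-2}A⁻¹`. [cite: LiuSlade2026, (5.2)–(5.4)] -/
theorem soPhiHat_update_eq_psi_sub_one (hd : 1 ≤ d) (k : Fin d → ℝ) (j : Fin d) (t : ℝ) :
    soPhiHat d L (Function.update k j t) =
      -1 + ((1 - soSymbol d L (Function.update k j t))⁻¹ -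
        (soVariance d L)⁻¹ * (1 - nnSymbol (Function.update k j t))⁻¹) := by
  rw [soPhiHat_eq_inv_sub hd]; ring

/-- `∂_j^m φ̂ = ψ^{(m)}` for `m ≥ 1`. [folklore] -/
theorem soPhiHatD_eq_iteratedDeriv_psi (hd : 1 ≤ d) {m : ℕ} (hm : 1 ≤ m) (k : Fin d → ℝ) (j : Fin d) :
    soPhiHatD d L j m k =
      iteratedDeriv m (fun t : ℝ => (1 - soSymbol d L (Function.update k j t))⁻¹ -
        (soVariance d L)⁻¹ * (1 - nnSymbol (Function.update k j t))⁻¹) (k j) := by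
  unfold soPhiHatD
  simp_rw [soPhiHat_update_eq_psi_sub_one hd]
  rw [iteratedDeriv_const_add (by omega)]

/-- **`|∂_j^m φ̂(k)| ≤ C_B‖k‖^{-m}_∞ + 1` on the small ball**, for all `m ≤ n` (`k` off the `j`-axis).
[cite: LiuSlade2026, proof of Lemma 5.1 (the contribution of B_L)] -/
theorem abs_soPhiHatD_le_ball (hd : 1 ≤ d) (hL : 1 ≤ L) {k : Fin d → ℝ} (hk : k ∈ cube d) {j : Fin d}
    (hk0 : Function.update k j 0 ≠ 0) (hball : (L : ℝ) * ‖k‖ ≤ 1) {n m : ℕ} (hm : m ≤ n) :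
    |soPhiHatD d L j m k| ≤ lem51CB n d * ‖k‖ ^ (-(m : ℤ)) + 1 := by
  have h := abs_iteratedDeriv_psi_le_ball hd hL hk hk0 hball n m hm
  rcases Nat.eq_zero_or_pos m with rfl | hm1
  · rw [soPhiHatD_zero]
    rw [iteratedDeriv_zero, Function.update_eq_self] at h
    have e := soPhiHat_update_eq_psi_sub_one (L := L) hd k j (k j)
    rw [Function.update_eq_self] at e
    rw [e]
    calc |-1 + ((1 - soSymbol d L k)⁻¹ - (soVariance d L)⁻¹ * (1 - nnSymbol k)⁻¹)|
        ≤ |(-1 : ℝ)| + |(1 - soSymbol d L k)⁻¹ - (soVariance d L)⁻¹ * (1 - nnSymbol k)⁻¹| := abs_add_le _ _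
      _ ≤ 1 + lem51CB n d * ‖k‖ ^ (-((0 : ℕ) : ℤ)) := by rw [abs_neg, abs_one]; exact add_le_add le_rfl h
      _ = lem51CB n d * ‖k‖ ^ (-((0 : ℕ) : ℤ)) + 1 := add_comm _ _
  · rw [soPhiHatD_eq_iteratedDeriv_psi hd hm1]
    linarith

/-! ## Pointwise bounds off the small ball -/

/-- **Off the small ball, `m ≥ 1`**: `|∂_j^m φ̂(k)| ≤ K₁ L^m M_L(k) + σ^{-2} K_A ‖k‖^{-2-m}_∞`
(`1 ≤ L‖k‖_∞`, `k` off the `j`-axis, `1 ≤ m ≤ n`). [cite: LiuSlade2026, proof of Lemma 5.1 (the contribution of 𝕋^d ∖ B_L: (5.5) from ‖D̂_α‖ bounds and Ĉ_α ≲ |k|^{-2-|α|})] -/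
theorem abs_soPhiHatD_le_off (hd : 1 ≤ d) (hL : 1 ≤ L) {k : Fin d → ℝ} (hk : k ∈ cube d) {j : Fin d}
    (hk0 : Function.update k j 0 ≠ 0) (hoff : 1 ≤ (L : ℝ) * ‖k‖) {n m : ℕ} (hm1 : 1 ≤ m) (hm : m ≤ n) :
    |soPhiHatD d L j m k| ≤ lem51K1 n * (L : ℝ) ^ m * dirichletMajorant (L : ℝ) k +
      (soVariance d L)⁻¹ * lem51KA n d * ‖k‖ ^ (-(2 : ℤ) - m) := by
  have hk1 : k ≠ 0 := fun h => hk0 (by rw [h]; simp)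
  have hρ : 0 < ‖k‖ := norm_pos_iff.2 hk1
  have hd0 : (0 : ℝ) < d := by exact_mod_cast (by omega : 0 < d)
  have hL0 : (0 : ℝ) < L := by exact_mod_cast (by omega : 0 < L)
  set lam : ℝ := (soVariance d L)⁻¹ with hlam
  set A : ℝ → ℝ := fun t => 1 - nnSymbol (Function.update k j t) with hA
  set F : ℝ → ℝ := fun t => 1 - soSymbol d L (Function.update k j t) with hF
  obtain ⟨hAc, hAne, hAlow, hAder⟩ := nnFactor_bounds hd hk hk0 n
  have hFc : ContDiff ℝ n F := contDiff_const.sub (contDiff_soSymbol_slice k j)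
  have hFne : ∀ t, F t ≠ 0 := fun t => (one_sub_soSymbol_update_pos hd hL hk hk0 t).ne'
  obtain ⟨hFlow, hFder⟩ := soFactor_bounds_off hd hL hk j hoff n
  have hAinv := abs_iteratedDeriv_inv_le_of_symbol (f := A) (s := k j) (a := 2) hρ
    (by positivity : (0 : ℝ) < 2 / (π ^ 2 * d)) (by positivity : (0 : ℝ) ≤ π ^ n) hAc hAne
    (by simp only [hA, Function.update_eq_self]; exact hAlow) hAder
  have hM0 : 0 ≤ dirichletMajorant (L : ℝ) k := (dirichletMajorant_pos _ _).le
  have hM1 : dirichletMajorant (L : ℝ) k ≤ 1 := dirichletMajorant_le_one _ _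
  have hFinv := abs_iteratedDeriv_inv_le_of_symbol_mul (f := F) (s := k j) (a := 0) (ρ := (L : ℝ)⁻¹)
    (inv_pos.2 hL0) (by norm_num : (0 : ℝ) < 1 / 16) (by norm_num : (0 : ℝ) ≤ 4) hM0 hM1 hFc hFne
    (by simp only [hF, Function.update_eq_self]; exact hFlow) hFder m hm1 hm
  -- `ψ^{(m)} = (F⁻¹)^{(m)} - λ (A⁻¹)^{(m)}`
  have hAic : ContDiffAt ℝ m (fun t => (A t)⁻¹) (k j) :=
    ((hAc.inv hAne).of_le (by exact_mod_cast hm)).contDiffAt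
  have hFic : ContDiffAt ℝ m (fun t => (F t)⁻¹) (k j) :=
    ((hFc.inv hFne).of_le (by exact_mod_cast hm)).contDiffAt
  have hsplit : iteratedDeriv m (fun t : ℝ => (F t)⁻¹ - lam * (A t)⁻¹) (k j) =
      iteratedDeriv m (fun t => (F t)⁻¹) (k j) - lam * iteratedDeriv m (fun t => (A t)⁻¹) (k j) := by
    rw [iteratedDeriv_fun_sub hFic (hAic.const_smul lam |>.congr_of_eventuallyEq ?_),
      show (fun t : ℝ => lam * (A t)⁻¹) = fun t => lam * (fun t => (A t)⁻¹) t from rfl,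
      iteratedDeriv_const_mul _ hAic]
    exact Filter.Eventually.of_forall fun t => by simp [smul_eq_mul]
  rw [soPhiHatD_eq_iteratedDeriv_psi hd hm1, show (fun t : ℝ => (1 - soSymbol d L (Function.update k j t))⁻¹ -
      (soVariance d L)⁻¹ * (1 - nnSymbol (Function.update k j t))⁻¹) = fun t => (F t)⁻¹ - lam * (A t)⁻¹ from rfl,
    hsplit]
  have h1 := hFinv
  have h2 := hAinv m hm
  have hzpow : ((L : ℝ)⁻¹) ^ (-(0 : ℤ) - m) = (L : ℝ) ^ m := by
    rw [neg_zero, zero_sub, zpow_neg, zpow_natCast, inv_pow, inv_inv]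
  rw [hzpow] at h1
  have hlam0 : 0 ≤ lam := by rw [hlam]; exact (inv_pos.2 (soVariance_pos hd hL)).le
  calc |iteratedDeriv m (fun t => (F t)⁻¹) (k j) - lam * iteratedDeriv m (fun t => (A t)⁻¹) (k j)|
      ≤ |iteratedDeriv m (fun t => (F t)⁻¹) (k j)| + |lam * iteratedDeriv m (fun t => (A t)⁻¹) (k j)| :=
        abs_sub _ _
    _ ≤ lem51K1 n * (L : ℝ) ^ m * dirichletMajorant (L : ℝ) k + lam * (lem51KA n d * ‖k‖ ^ (-(2 : ℤ) - m)) := by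
        refine add_le_add h1 ?_
        rw [abs_mul, abs_of_nonneg hlam0]
        exact mul_le_mul_of_nonneg_left h2 hlam0
    _ = _ := by ring

/-- **Off the small ball, `m = 0`**: `|φ̂(k)| ≤ 16|D̂(k)| + σ^{-2}(π²d/2)‖k‖^{-2}_∞ ≤
32 M_L(k) + 16/N_L + σ^{-2}(π²d/2)‖k‖^{-2}_∞` (`1 ≤ L‖k‖_∞`). [cite: LiuSlade2026, proof of Lemma 5.1 (φ̂ = D̂f̂ - σ^{-2}ĈF̂; |α| = 0)] -/
theorem abs_soPhiHat_le_off (hd : 1 ≤ d) (hL : 1 ≤ L) {k : Fin d → ℝ} (hk : k ∈ cube d) (hk1 : k ≠ 0)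
    (hoff : 1 ≤ (L : ℝ) * ‖k‖) :
    |soPhiHat d L k| ≤ 32 * dirichletMajorant (L : ℝ) k + 16 * ((soCount d L : ℝ))⁻¹ +
      (soVariance d L)⁻¹ * (π ^ 2 * d / 2) * ‖k‖ ^ (-(2 : ℤ)) := by
  have hρ : 0 < ‖k‖ := norm_pos_iff.2 hk1
  have hd0 : (0 : ℝ) < d := by exact_mod_cast (by omega : 0 < d)
  have hF : 1 / 16 ≤ 1 - soSymbol d L k := one_sub_soSymbol_ge_of_le hd hL hk hoff
  have hFpos : 0 < 1 - soSymbol d L k := by linarith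
  have hA : 2 / (π ^ 2 * d) * ‖k‖ ^ 2 ≤ 1 - nnSymbol k := by
    rw [one_sub_nnSymbol hd]
    have h := mul_norm_sq_le_dispersion (d := d) hk
    calc 2 / (π ^ 2 * d) * ‖k‖ ^ 2 = (2 / π ^ 2 * ‖k‖ ^ 2) / d := by field_simp
      _ ≤ dispersion k / d := div_le_div_of_nonneg_right h hd0.le
  have hApos : 0 < 1 - nnSymbol k := lt_of_lt_of_le (by positivity) hA
  have hlam0 : 0 ≤ (soVariance d L)⁻¹ := (inv_pos.2 (soVariance_pos hd hL)).le
  -- `φ̂ = D̂/(1 - D̂) - λ/A`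
  have hφ : soPhiHat d L k = soSymbol d L k / (1 - soSymbol d L k) - (soVariance d L)⁻¹ * (1 - nnSymbol k)⁻¹ := by
    rw [soPhiHat_eq_inv_sub hd]
    field_simp
    ring
  have hD := abs_soSymbol_le_dirichletMajorant hd hL hk
  have h1 : |soSymbol d L k / (1 - soSymbol d L k)| ≤ 16 * (2 * dirichletMajorant (L : ℝ) k + ((soCount d L : ℝ))⁻¹) := by
    rw [abs_div, abs_of_pos hFpos, div_le_iff₀ hFpos]
    calc |soSymbol d L k| ≤ 2 * dirichletMajorant (L : ℝ) k + ((soCount d L : ℝ))⁻¹ := hD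
      _ = 16 * (2 * dirichletMajorant (L : ℝ) k + ((soCount d L : ℝ))⁻¹) * (1 / 16) := by ring
      _ ≤ 16 * (2 * dirichletMajorant (L : ℝ) k + ((soCount d L : ℝ))⁻¹) * (1 - soSymbol d L k) := by
          refine mul_le_mul_of_nonneg_left hF ?_
          have := (dirichletMajorant_pos (L : ℝ) k).le
          have : (0 : ℝ) ≤ ((soCount d L : ℝ))⁻¹ := by positivity
          positivity
  have h2 : (1 - nnSymbol k)⁻¹ ≤ π ^ 2 * d / 2 * ‖k‖ ^ (-(2 : ℤ)) := by
    rw [zpow_neg, show ‖k‖ ^ (2 : ℤ) = ‖k‖ ^ 2 from zpow_ofNat ‖k‖ 2]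
    calc (1 - nnSymbol k)⁻¹ ≤ (2 / (π ^ 2 * d) * ‖k‖ ^ 2)⁻¹ := inv_anti₀ (by positivity) hA
      _ = π ^ 2 * d / 2 * (‖k‖ ^ 2)⁻¹ := by field_simp
  rw [hφ]
  calc |soSymbol d L k / (1 - soSymbol d L k) - (soVariance d L)⁻¹ * (1 - nnSymbol k)⁻¹|
      ≤ |soSymbol d L k / (1 - soSymbol d L k)| + |(soVariance d L)⁻¹ * (1 - nnSymbol k)⁻¹| := abs_sub _ _
    _ ≤ 16 * (2 * dirichletMajorant (L : ℝ) k + ((soCount d L : ℝ))⁻¹) +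
        (soVariance d L)⁻¹ * (π ^ 2 * d / 2 * ‖k‖ ^ (-(2 : ℤ))) := by
        refine add_le_add h1 ?_
        rw [abs_mul, abs_of_nonneg hlam0, abs_of_pos (inv_pos.2 hApos)]
        exact mul_le_mul_of_nonneg_left h2 hlam0
    _ = _ := by ring

/-! ## The integrable majorant -/

/-- `(ρ^a)⁻¹ ≤ R^b (ρ^b)⁻¹` for `0 < ρ ≤ R`, `1 ≤ R`, `a ≤ b`. [folklore] -/
theorem inv_pow_le_pow_mul_inv_pow {ρ R : ℝ} (hρ : 0 < ρ) (hρR : ρ ≤ R) (hR : 1 ≤ R) {a b : ℕ} (hab : a ≤ b) :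
    (ρ ^ a)⁻¹ ≤ R ^ b * (ρ ^ b)⁻¹ := by
  rw [← div_eq_mul_inv, le_div_iff₀ (pow_pos hρ b), inv_mul_le_iff₀ (pow_pos hρ a)]
  obtain ⟨c, rfl⟩ := Nat.exists_eq_add_of_le hab
  calc ρ ^ (a + c) = ρ ^ a * ρ ^ c := pow_add _ _ _
    _ ≤ ρ ^ a * R ^ c := mul_le_mul_of_nonneg_left (pow_le_pow_left₀ hρ.le hρR c) (pow_nonneg hρ.le a)
    _ ≤ ρ ^ a * R ^ (a + c) :=
        mul_le_mul_of_nonneg_left (pow_le_pow_right₀ hR (by omega)) (pow_nonneg hρ.le a)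

/-- The constant of the `F⁻¹`/`D̂` terms off the small ball. [folklore] -/
def lem51K2 (n : ℕ) : ℝ := max (lem51K1 n) 32

/-- The constant of the `σ^{-2}` terms off the small ball. [folklore] -/
def lem51K3 (n d : ℕ) : ℝ := (lem51KA n d + π ^ 2 * d) * π ^ (d + 1)

/-- **The integrable majorant** of `∂_j^m φ̂` on `[-π,π]^d` (`m ≤ n`):
`G(k) = (C_B+1)·1_{‖k‖≤1/L}‖k‖^{-(d-1)} + K₂ L^m M_L(k) + 16/N_L + σ^{-2}K₃·1_{‖k‖≥1/L}‖k‖^{-(d+1)}`.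
[cite: LiuSlade2026, proof of Lemma 5.1] -/
def lem51Majorant (d L n m : ℕ) (k : Fin d → ℝ) : ℝ :=
  (lem51CB n d + 1) * ballProfile d ((L : ℝ)⁻¹) ‖k‖ +
    lem51K2 n * (L : ℝ) ^ m * dirichletMajorant (L : ℝ) k + 16 * ((soCount d L : ℝ))⁻¹ +
      (soVariance d L)⁻¹ * lem51K3 n d * annulusProfile d ((L : ℝ)⁻¹) ‖k‖

/-- **Pointwise domination**: `|∂_j^m φ̂(k)| ≤ G(k)` for `k ∈ [-π,π]^d` off the `j`-axis, `m ≤ n`,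
`n + 1 = d`, `L ≥ 1`. [cite: LiuSlade2026, proof of Lemma 5.1] -/
theorem abs_soPhiHatD_le_majorant (hL : 1 ≤ L) {k : Fin d → ℝ} (hk : k ∈ cube d)
    {j : Fin d} (hk0 : Function.update k j 0 ≠ 0) {n m : ℕ} (hm : m ≤ n) (hnd : n + 1 = d) :
    |soPhiHatD d L j m k| ≤ lem51Majorant d L n m k := by
  have hd : 1 ≤ d := by omega
  have hk1 : k ≠ 0 := fun h => hk0 (by rw [h]; simp)
  have hρ : 0 < ‖k‖ := norm_pos_iff.2 hk1
  have hd0 : (0 : ℝ) < d := by exact_mod_cast (by omega : 0 < d)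
  have hL0 : (0 : ℝ) < L := by exact_mod_cast (by omega : 0 < L)
  have hL1 : (1 : ℝ) ≤ L := by exact_mod_cast hL
  have hρπ : ‖k‖ ≤ π := by
    refine (pi_norm_le_iff_of_nonneg Real.pi_pos.le).2 fun i => ?_
    have := hk i (Set.mem_univ _)
    rw [Real.norm_eq_abs]; exact abs_le.2 ⟨this.1, this.2⟩
  have hπ1 : (1 : ℝ) ≤ π := by linarith [Real.pi_gt_three]
  have hlam0 : 0 ≤ (soVariance d L)⁻¹ := (inv_pos.2 (soVariance_pos hd hL)).le
  have hCB0 : 0 ≤ lem51CB n d := (lem51CB_pos hd n).le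
  have hKA0 : 0 ≤ lem51KA n d := (lem51KA_pos hd n).le
  have hK20 : 0 ≤ lem51K2 n := le_trans (lem51K1_pos n).le (le_max_left _ _)
  have hK30 : 0 ≤ lem51K3 n d := by unfold lem51K3; positivity
  have hM0 : 0 ≤ dirichletMajorant (L : ℝ) k := (dirichletMajorant_pos _ _).le
  have hN0 : (0 : ℝ) ≤ ((soCount d L : ℝ))⁻¹ := by positivity
  have hball0 : 0 ≤ ballProfile d ((L : ℝ)⁻¹) ‖k‖ := ballProfile_nonneg d _ hρ.le
  have hann0 : 0 ≤ annulusProfile d ((L : ℝ)⁻¹) ‖k‖ := annulusProfile_nonneg d _ hρ.le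
  have hT1 : 0 ≤ (lem51CB n d + 1) * ballProfile d ((L : ℝ)⁻¹) ‖k‖ := by positivity
  have hT2 : 0 ≤ lem51K2 n * (L : ℝ) ^ m * dirichletMajorant (L : ℝ) k := by positivity
  have hT3 : 0 ≤ 16 * ((soCount d L : ℝ))⁻¹ := by positivity
  have hT4 : 0 ≤ (soVariance d L)⁻¹ * lem51K3 n d * annulusProfile d ((L : ℝ)⁻¹) ‖k‖ := by positivity
  unfold lem51Majorant
  by_cases hcase : (L : ℝ) * ‖k‖ ≤ 1
  · -- the small ball
    have h := abs_soPhiHatD_le_ball hd hL hk hk0 hcase hm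
    have hρL : ‖k‖ ≤ (L : ℝ)⁻¹ := by rw [← one_div, le_div_iff₀ hL0, mul_comm]; exact hcase
    have hρ1 : ‖k‖ ≤ 1 := hρL.trans (inv_le_one_of_one_le₀ hL1)
    have hbp : ballProfile d ((L : ℝ)⁻¹) ‖k‖ = (‖k‖ ^ (d - 1))⁻¹ := by rw [ballProfile, if_pos hρL]
    have hz : ‖k‖ ^ (-(m : ℤ)) ≤ (‖k‖ ^ (d - 1))⁻¹ := by
      rw [zpow_neg, zpow_natCast]
      exact inv_anti₀ (pow_pos hρ _) (pow_le_pow_of_le_one hρ.le hρ1 (by omega))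
    have h1 : (1 : ℝ) ≤ (‖k‖ ^ (d - 1))⁻¹ := one_le_inv_iff₀.2 ⟨pow_pos hρ _, pow_le_one₀ hρ.le hρ1⟩
    calc |soPhiHatD d L j m k| ≤ lem51CB n d * ‖k‖ ^ (-(m : ℤ)) + 1 := h
      _ ≤ lem51CB n d * (‖k‖ ^ (d - 1))⁻¹ + (‖k‖ ^ (d - 1))⁻¹ :=
          add_le_add (mul_le_mul_of_nonneg_left hz hCB0) h1
      _ = (lem51CB n d + 1) * ballProfile d ((L : ℝ)⁻¹) ‖k‖ := by rw [hbp]; ring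
      _ ≤ _ := by linarith
  · -- off the small ball
    rw [not_le] at hcase
    have hoff : 1 ≤ (L : ℝ) * ‖k‖ := hcase.le
    have hρL : (L : ℝ)⁻¹ ≤ ‖k‖ := by
      rw [← one_div, div_le_iff₀ hL0, mul_comm]; exact hoff
    have hap : annulusProfile d ((L : ℝ)⁻¹) ‖k‖ = (‖k‖ ^ (d + 1))⁻¹ := by rw [annulusProfile, if_pos hρL]
    -- the `σ^{-2}` terms: `ρ^{-2-m} ≤ π^{d+1} ρ^{-(d+1)}`
    have hz : ∀ a : ℕ, a ≤ d + 1 → (‖k‖ ^ a)⁻¹ ≤ π ^ (d + 1) * (‖k‖ ^ (d + 1))⁻¹ := fun a ha =>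
      inv_pow_le_pow_mul_inv_pow hρ hρπ hπ1 ha
    rcases Nat.eq_zero_or_pos m with rfl | hm1
    · -- `m = 0`
      rw [soPhiHatD_zero, pow_zero, mul_one]
      have h := abs_soPhiHat_le_off hd hL hk hk1 hoff
      have hz2 : π ^ 2 * d / 2 * ‖k‖ ^ (-(2 : ℤ)) ≤ lem51K3 n d * (‖k‖ ^ (d + 1))⁻¹ := by
        rw [zpow_neg, show ‖k‖ ^ (2 : ℤ) = ‖k‖ ^ 2 from zpow_ofNat ‖k‖ 2]
        calc π ^ 2 * d / 2 * (‖k‖ ^ 2)⁻¹ ≤ (π ^ 2 * d) * (π ^ (d + 1) * (‖k‖ ^ (d + 1))⁻¹) :=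
              mul_le_mul (by linarith [show (0 : ℝ) ≤ π ^ 2 * d by positivity]) (hz 2 (by omega))
                (by positivity) (by positivity)
          _ ≤ lem51K3 n d * (‖k‖ ^ (d + 1))⁻¹ := by
              rw [← mul_assoc]
              refine mul_le_mul_of_nonneg_right ?_ (by positivity)
              unfold lem51K3
              exact mul_le_mul_of_nonneg_right (by linarith) (by positivity)
      calc |soPhiHat d L k| ≤ 32 * dirichletMajorant (L : ℝ) k + 16 * ((soCount d L : ℝ))⁻¹ +
            (soVariance d L)⁻¹ * (π ^ 2 * d / 2) * ‖k‖ ^ (-(2 : ℤ)) := h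
        _ ≤ lem51K2 n * dirichletMajorant (L : ℝ) k + 16 * ((soCount d L : ℝ))⁻¹ +
            (soVariance d L)⁻¹ * lem51K3 n d * annulusProfile d ((L : ℝ)⁻¹) ‖k‖ := by
            refine add_le_add (add_le_add (mul_le_mul_of_nonneg_right (le_max_right _ _) hM0) le_rfl) ?_
            rw [hap, mul_assoc, mul_assoc]
            exact mul_le_mul_of_nonneg_left hz2 hlam0
        _ ≤ _ := by linarith
    · -- `m ≥ 1`
      have h := abs_soPhiHatD_le_off hd hL hk hk0 hoff hm1 hm
      have hz2 : lem51KA n d * ‖k‖ ^ (-(2 : ℤ) - m) ≤ lem51K3 n d * (‖k‖ ^ (d + 1))⁻¹ := by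
        rw [show (-(2 : ℤ) - m) = -((m + 2 : ℕ) : ℤ) by push_cast; ring, zpow_neg, zpow_natCast]
        calc lem51KA n d * (‖k‖ ^ (m + 2))⁻¹ ≤ lem51KA n d * (π ^ (d + 1) * (‖k‖ ^ (d + 1))⁻¹) :=
              mul_le_mul_of_nonneg_left (hz (m + 2) (by omega)) hKA0
          _ ≤ lem51K3 n d * (‖k‖ ^ (d + 1))⁻¹ := by
              rw [← mul_assoc]
              refine mul_le_mul_of_nonneg_right ?_ (by positivity)
              unfold lem51K3
              refine mul_le_mul_of_nonneg_right ?_ (by positivity)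
              linarith [show (0 : ℝ) ≤ π ^ 2 * d by positivity]
      calc |soPhiHatD d L j m k| ≤ lem51K1 n * (L : ℝ) ^ m * dirichletMajorant (L : ℝ) k +
            (soVariance d L)⁻¹ * lem51KA n d * ‖k‖ ^ (-(2 : ℤ) - m) := h
        _ ≤ lem51K2 n * (L : ℝ) ^ m * dirichletMajorant (L : ℝ) k +
            (soVariance d L)⁻¹ * lem51K3 n d * annulusProfile d ((L : ℝ)⁻¹) ‖k‖ := by
            refine add_le_add ?_ ?_
            · exact mul_le_mul_of_nonneg_right (mul_le_mul_of_nonneg_right (le_max_left _ _) (by positivity)) hM0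
            · rw [hap, mul_assoc, mul_assoc]
              exact mul_le_mul_of_nonneg_left hz2 hlam0
        _ ≤ _ := by linarith

/-! ## The integral of the majorant -/

/-- The total constant. [folklore] -/
def lem51Ktot (n d : ℕ) : ℝ :=
  (lem51CB n d + 1) * d * 2 ^ d + lem51K2 n * (2 * π) ^ d + 16 * (2 * π) ^ d + 3 * lem51K3 n d * 2 ^ d

/-- The cube has volume at most `(2π)^d` (it is contained in the closed sup-norm ball of radius `π`).
[folklore] -/
theorem volumeReal_cube_le (d : ℕ) : volume.real (cube d) ≤ (2 * π) ^ d := by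
  have hsub : cube d ⊆ Metric.closedBall (0 : Fin d → ℝ) π := by
    intro k hk
    rw [Metric.mem_closedBall, dist_zero_right]
    refine (pi_norm_le_iff_of_nonneg Real.pi_pos.le).2 fun i => ?_
    have := hk i (Set.mem_univ _)
    rw [Real.norm_eq_abs]; exact abs_le.2 ⟨this.1, this.2⟩
  calc volume.real (cube d) ≤ volume.real (Metric.closedBall (0 : Fin d → ℝ) π) :=
        measureReal_mono hsub (by rw [Real.volume_pi_closedBall _ Real.pi_pos.le]; exact ENNReal.ofReal_ne_top)
    _ = (2 * π) ^ d := by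
        rw [measureReal_def, Real.volume_pi_closedBall _ Real.pi_pos.le, Fintype.card_fin,
          ENNReal.toReal_ofReal (by positivity)]

/-- The majorant is integrable on the cube. [folklore] -/
theorem integrableOn_lem51Majorant (hd : 1 ≤ d) (hL : 1 ≤ L) (n m : ℕ) :
    IntegrableOn (lem51Majorant d L n m) (cube d) volume := by
  have hL0 : (0 : ℝ) < L := by exact_mod_cast (by omega : 0 < L)
  have hfin : volume (cube d) ≠ ⊤ := (isCompact_univ_pi fun _ => isCompact_Icc).measure_lt_top.ne
  unfold lem51Majorant
  refine ((Integrable.add (Integrable.add ?_ ?_) ?_).add ?_)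
  · exact ((integrable_ballProfile_norm hd _).const_mul _).integrableOn
  · have h := (integrableOn_dirichletMajorant (d := d) (L : ℝ)).const_mul (lem51K2 n * (L : ℝ) ^ m)
    exact h
  · exact integrableOn_const hfin
  · exact ((integrable_annulusProfile_norm hd (inv_pos.2 hL0)).const_mul _).integrableOn

/-- **`∫_{[-π,π]^d} G ≤ K_tot (1 + log L)^d / L`** (`m ≤ n`, `n + 1 = d`, `L ≥ 1`).
[cite: LiuSlade2026, Lemma 5.1 (5.5) (‖φ̂_α‖_1 ≲ L^{-(1-ε)})] -/
theorem integral_lem51Majorant_le (hL : 1 ≤ L) {n m : ℕ} (hm : m ≤ n) (hnd : n + 1 = d) :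
    ∫ k in cube d, lem51Majorant d L n m k ≤ lem51Ktot n d * (1 + Real.log L) ^ d / L := by
  have hd : 1 ≤ d := by omega
  have hd0 : (0 : ℝ) < d := by exact_mod_cast (by omega : 0 < d)
  have hL0 : (0 : ℝ) < L := by exact_mod_cast (by omega : 0 < L)
  have hL1 : (1 : ℝ) ≤ L := by exact_mod_cast hL
  have hfin : volume (cube d) ≠ ⊤ := (isCompact_univ_pi fun _ => isCompact_Icc).measure_lt_top.ne
  have hlog0 : 0 ≤ Real.log L := Real.log_nonneg hL1
  have hlog1 : 1 ≤ (1 + Real.log L) ^ d := one_le_pow₀ (by linarith)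
  have hCB0 : 0 ≤ lem51CB n d := (lem51CB_pos hd n).le
  have hK20 : 0 ≤ lem51K2 n := le_trans (lem51K1_pos n).le (le_max_left _ _)
  have hK30 : 0 ≤ lem51K3 n d := by
    unfold lem51K3; have := (lem51KA_pos hd n).le; positivity
  have hlam0 : 0 ≤ (soVariance d L)⁻¹ := (inv_pos.2 (soVariance_pos hd hL)).le
  have hlam : (soVariance d L)⁻¹ ≤ 3 / (d * (L : ℝ) ^ 2) := inv_soVariance_le hd hL
  have hN : (0 : ℝ) < soCount d L := by exact_mod_cast soCount_pos hd hL
  have hNL : ((soCount d L : ℝ))⁻¹ ≤ (L : ℝ)⁻¹ := by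
    refine inv_anti₀ hL0 ?_
    have h1 : (L : ℝ) ^ d ≤ soCount d L := by exact_mod_cast pow_le_soCount hd L
    exact le_trans (by simpa using pow_le_pow_right₀ hL1 hd) h1
  -- the four integrals
  have hI1 : ∫ k in cube d, (lem51CB n d + 1) * ballProfile d ((L : ℝ)⁻¹) ‖k‖ ≤
      (lem51CB n d + 1) * (d * 2 ^ d * (L : ℝ)⁻¹) := by
    rw [integral_const_mul]
    refine mul_le_mul_of_nonneg_left ?_ (by positivity)
    rw [← integral_norm_pow_inv_ball hd (inv_pos.2 hL0)]
    exact setIntegral_le_integral (integrable_ballProfile_norm hd _)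
      (Eventually.of_forall fun k => ballProfile_nonneg d _ (norm_nonneg k))
  have hI2 : ∫ k in cube d, lem51K2 n * (L : ℝ) ^ m * dirichletMajorant (L : ℝ) k ≤
      lem51K2 n * ((2 * π) ^ d * (1 + Real.log L) ^ d / L) := by
    rw [integral_const_mul, mul_assoc]
    refine mul_le_mul_of_nonneg_left ?_ hK20
    have h := integral_cube_dirichletMajorant_le (d := d) hL1
    calc (L : ℝ) ^ m * ∫ k in cube d, dirichletMajorant (L : ℝ) k
        ≤ (L : ℝ) ^ m * (2 * π / L * (1 + Real.log L)) ^ d := mul_le_mul_of_nonneg_left h (by positivity)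
      _ = (2 * π) ^ d * (1 + Real.log L) ^ d * ((L : ℝ) ^ m / (L : ℝ) ^ d) := by
          rw [mul_pow, div_pow]; ring
      _ ≤ (2 * π) ^ d * (1 + Real.log L) ^ d * (1 / L) := by
          refine mul_le_mul_of_nonneg_left ?_ (by positivity)
          rw [div_le_div_iff₀ (by positivity) hL0, one_mul, ← pow_succ]
          exact pow_le_pow_right₀ hL1 (by omega)
      _ = (2 * π) ^ d * (1 + Real.log L) ^ d / L := by ring
  have hI3 : ∫ _k in cube d, (16 : ℝ) * ((soCount d L : ℝ))⁻¹ ≤ 16 * ((2 * π) ^ d * (L : ℝ)⁻¹) := by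
    rw [setIntegral_const, smul_eq_mul]
    calc volume.real (cube d) * (16 * ((soCount d L : ℝ))⁻¹) ≤ (2 * π) ^ d * (16 * (L : ℝ)⁻¹) :=
          mul_le_mul (volumeReal_cube_le d) (mul_le_mul_of_nonneg_left hNL (by norm_num)) (by positivity)
            (by positivity)
      _ = 16 * ((2 * π) ^ d * (L : ℝ)⁻¹) := by ring
  have hI4 : ∫ k in cube d, (soVariance d L)⁻¹ * lem51K3 n d * annulusProfile d ((L : ℝ)⁻¹) ‖k‖ ≤
      3 * lem51K3 n d * 2 ^ d * (L : ℝ)⁻¹ := by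
    rw [integral_const_mul]
    have hann : ∫ k in cube d, annulusProfile d ((L : ℝ)⁻¹) ‖k‖ ≤ d * 2 ^ d * ((L : ℝ)⁻¹)⁻¹ := by
      rw [← integral_norm_pow_inv_annulus hd (inv_pos.2 hL0)]
      exact setIntegral_le_integral (integrable_annulusProfile_norm hd (inv_pos.2 hL0))
        (Eventually.of_forall fun k => annulusProfile_nonneg d _ (norm_nonneg k))
    rw [inv_inv] at hann
    calc (soVariance d L)⁻¹ * lem51K3 n d * ∫ k in cube d, annulusProfile d ((L : ℝ)⁻¹) ‖k‖
        ≤ 3 / (d * (L : ℝ) ^ 2) * lem51K3 n d * (d * 2 ^ d * L) := by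
          refine mul_le_mul (mul_le_mul_of_nonneg_right hlam hK30) hann ?_ (by positivity)
          exact setIntegral_nonneg (measurableSet_brillouin d) fun k _ => annulusProfile_nonneg d _ (norm_nonneg k)
      _ = 3 * lem51K3 n d * 2 ^ d * (L : ℝ)⁻¹ := by field_simp
  -- add up
  have hint1 : IntegrableOn (fun k => (lem51CB n d + 1) * ballProfile d ((L : ℝ)⁻¹) ‖k‖) (cube d) volume :=
    ((integrable_ballProfile_norm hd _).const_mul _).integrableOn
  have hint2 : IntegrableOn (fun k => lem51K2 n * (L : ℝ) ^ m * dirichletMajorant (L : ℝ) k) (cube d) volume :=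
    (integrableOn_dirichletMajorant (d := d) (L : ℝ)).const_mul (lem51K2 n * (L : ℝ) ^ m)
  have hint3 : IntegrableOn (fun _ : Fin d → ℝ => (16 : ℝ) * ((soCount d L : ℝ))⁻¹) (cube d) volume :=
    integrableOn_const hfin
  have hint4 : IntegrableOn (fun k => (soVariance d L)⁻¹ * lem51K3 n d * annulusProfile d ((L : ℝ)⁻¹) ‖k‖)
      (cube d) volume :=
    ((integrable_annulusProfile_norm hd (inv_pos.2 hL0)).const_mul _).integrableOn
  have hsplit : ∫ k in cube d, lem51Majorant d L n m k =
      (∫ k in cube d, (lem51CB n d + 1) * ballProfile d ((L : ℝ)⁻¹) ‖k‖) +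
      (∫ k in cube d, lem51K2 n * (L : ℝ) ^ m * dirichletMajorant (L : ℝ) k) +
      (∫ _k in cube d, (16 : ℝ) * ((soCount d L : ℝ))⁻¹) +
      ∫ k in cube d, (soVariance d L)⁻¹ * lem51K3 n d * annulusProfile d ((L : ℝ)⁻¹) ‖k‖ := by
    have hint12 : Integrable (fun k => (lem51CB n d + 1) * ballProfile d ((L : ℝ)⁻¹) ‖k‖ +
        lem51K2 n * (L : ℝ) ^ m * dirichletMajorant (L : ℝ) k) (volume.restrict (cube d)) := hint1.add hint2
    have hint123 : Integrable (fun k => (lem51CB n d + 1) * ballProfile d ((L : ℝ)⁻¹) ‖k‖ +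
        lem51K2 n * (L : ℝ) ^ m * dirichletMajorant (L : ℝ) k + 16 * ((soCount d L : ℝ))⁻¹)
        (volume.restrict (cube d)) := hint12.add hint3
    unfold lem51Majorant
    rw [integral_add hint123 hint4, integral_add hint12 hint3, integral_add hint1 hint2]
  rw [hsplit]
  have htot : (lem51CB n d + 1) * (d * 2 ^ d * (L : ℝ)⁻¹) + lem51K2 n * ((2 * π) ^ d * (1 + Real.log L) ^ d / L) +
      16 * ((2 * π) ^ d * (L : ℝ)⁻¹) + 3 * lem51K3 n d * 2 ^ d * (L : ℝ)⁻¹ ≤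
      lem51Ktot n d * (1 + Real.log L) ^ d / L := by
    unfold lem51Ktot
    rw [div_eq_mul_inv, div_eq_mul_inv]
    have e : ((lem51CB n d + 1) * d * 2 ^ d + lem51K2 n * (2 * π) ^ d + 16 * (2 * π) ^ d +
        3 * lem51K3 n d * 2 ^ d) * (1 + Real.log L) ^ d * (L : ℝ)⁻¹ =
        ((lem51CB n d + 1) * d * 2 ^ d * (L : ℝ)⁻¹ + 16 * (2 * π) ^ d * (L : ℝ)⁻¹ +
          3 * lem51K3 n d * 2 ^ d * (L : ℝ)⁻¹) * (1 + Real.log L) ^ d +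
        lem51K2 n * ((2 * π) ^ d * (1 + Real.log L) ^ d * (L : ℝ)⁻¹) := by ring
    rw [e]
    have hA : 0 ≤ (lem51CB n d + 1) * d * 2 ^ d * (L : ℝ)⁻¹ + 16 * (2 * π) ^ d * (L : ℝ)⁻¹ +
        3 * lem51K3 n d * 2 ^ d * (L : ℝ)⁻¹ := by positivity
    nlinarith [mul_le_mul_of_nonneg_left hlog1 hA]
  linarith [add_le_add (add_le_add (add_le_add hI1 hI2) hI3) hI4]

/-- `(1 + log L)^d ≤ (1 + d/ε)^d L^ε` for `L ≥ 1`, `ε > 0`, `d ≥ 1` (`log L ≤ (d/ε)L^{ε/d}`). [folklore] -/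
theorem one_add_log_pow_le {Λ ε : ℝ} (hΛ : 1 ≤ Λ) (hε : 0 < ε) {d : ℕ} (hd : 1 ≤ d) :
    (1 + Real.log Λ) ^ d ≤ (1 + d / ε) ^ d * Λ ^ ε := by
  have hd0 : (0 : ℝ) < d := by exact_mod_cast (by omega : 0 < d)
  have hΛ0 : 0 ≤ Λ := zero_le_one.trans hΛ
  have hεd : 0 < ε / d := div_pos hε hd0
  have h1 : Real.log Λ ≤ d / ε * Λ ^ (ε / d) := by
    have := Real.log_le_rpow_div hΛ0 hεd
    calc Real.log Λ ≤ Λ ^ (ε / d) / (ε / d) := this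
      _ = d / ε * Λ ^ (ε / d) := by field_simp
  have h2 : 1 ≤ Λ ^ (ε / d) := Real.one_le_rpow hΛ hεd.le
  have h3 : 1 + Real.log Λ ≤ (1 + d / ε) * Λ ^ (ε / d) := by nlinarith [div_pos hd0 hε]
  have h4 : 0 ≤ 1 + Real.log Λ := by linarith [Real.log_nonneg hΛ]
  calc (1 + Real.log Λ) ^ d ≤ ((1 + d / ε) * Λ ^ (ε / d)) ^ d := pow_le_pow_left₀ h4 h3 d
    _ = (1 + d / ε) ^ d * Λ ^ ε := by
        rw [mul_pow, ← Real.rpow_natCast (Λ ^ (ε / d)) d, ← Real.rpow_mul hΛ0]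
        congr 2
        field_simp

/-! ## Lemma 5.1 and Proposition 1.2 -/

/-- Off the `j`-axis is almost everywhere on the cube (`d ≥ 2`). [folklore] -/
theorem ae_restrict_cube_update_ne_zero (hd : 2 ≤ d) (j : Fin d) :
    ∀ᵐ k ∂(volume.restrict (cube d)), k ∈ cube d ∧ Function.update k j 0 ≠ 0 := by
  haveI : Nontrivial (Fin d) := Fin.nontrivial_iff_two_le.2 hd
  obtain ⟨i₀, hi₀⟩ := exists_ne j
  have h0 : volume {k : Fin d → ℝ | k i₀ = 0} = 0 := by
    rw [volume_pi]; exact Measure.pi_hyperplane _ i₀ 0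
  have hae : ∀ᵐ k ∂(volume : Measure (Fin d → ℝ)), k i₀ ≠ 0 := by
    rw [ae_iff]; simpa using h0
  filter_upwards [ae_restrict_mem (measurableSet_brillouin d), ae_restrict_of_ae hae] with k hk hk0
  refine ⟨hk, fun h => hk0 ?_⟩
  have := congrFun h i₀
  rwa [Function.update_of_ne hi₀] at this

/-- **Liu–Slade 2026, Lemma 5.1 (5.5) for pure derivatives, proved**: the named fact
`LiuSlade2026_lem51_L1` holds, with `L₀ = 1` and `C = K_tot(d) (1 + d/ε)^d`.
[cite: LiuSlade2026, Lemma 5.1 with (5.5)] -/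
theorem LiuSlade2026_lem51_L1_holds : LiuSlade2026_lem51_L1 := by
  intro d hd ε hε
  set n : ℕ := d - 1 with hn
  have hnd : n + 1 = d := by omega
  have hd1 : 1 ≤ d := by omega
  refine ⟨lem51Ktot n d * (1 + d / ε) ^ d, 1, le_rfl, fun L hL j m hm => ?_⟩
  have hL0 : (0 : ℝ) < L := by exact_mod_cast (by omega : 0 < L)
  have hL1 : (1 : ℝ) ≤ L := by exact_mod_cast hL
  have hmn : m ≤ n := by omega
  have hG := integrableOn_lem51Majorant hd1 hL n m
  have hae : ∀ᵐ k ∂(volume.restrict (cube d)), ‖soPhiHatD d L j m k‖ ≤ lem51Majorant d L n m k := by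
    filter_upwards [ae_restrict_cube_update_ne_zero (by omega) j] with k hk
    rw [Real.norm_eq_abs]
    exact abs_soPhiHatD_le_majorant hL hk.1 hk.2 hmn hnd
  have hint : IntegrableOn (soPhiHatD d L j m) (cube d) volume :=
    Integrable.mono' hG (aestronglyMeasurable_soPhiHatD hd1 hL j m) hae
  refine ⟨hint, ?_⟩
  have hKtot0 : 0 ≤ lem51Ktot n d := by
    unfold lem51Ktot
    have := (lem51CB_pos hd1 n).le
    have : 0 ≤ lem51K2 n := le_trans (lem51K1_pos n).le (le_max_left _ _)
    have : 0 ≤ lem51K3 n d := by unfold lem51K3; have := (lem51KA_pos hd1 n).le; positivity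
    positivity
  calc ∫ k in cube d, |soPhiHatD d L j m k| ≤ ∫ k in cube d, lem51Majorant d L n m k := by
        refine integral_mono_ae hint.abs hG ?_
        filter_upwards [hae] with k hk
        rwa [Real.norm_eq_abs] at hk
    _ ≤ lem51Ktot n d * (1 + Real.log L) ^ d / L := integral_lem51Majorant_le hL hmn hnd
    _ ≤ lem51Ktot n d * ((1 + d / ε) ^ d * (L : ℝ) ^ ε) / L := by
        refine div_le_div_of_nonneg_right (mul_le_mul_of_nonneg_left (one_add_log_pow_le hL1 hε hd1) hKtot0) hL0.le
    _ = lem51Ktot n d * (1 + d / ε) ^ d / (L : ℝ) ^ (1 - ε) := by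
        rw [Real.rpow_sub hL0, Real.rpow_one]
        field_simp

/-- **Liu–Slade 2026, Proposition 1.2, first display (1.9), proved** for Sakai's uniformly spread-out
walk: `S_1(x) = δ_{0,x} + C_1(x)/σ² + O(L^{-(1-ε)}⟦x⟧^{-(d-1)})` with the constant uniform in `L ≥ L₀`
— the named fact `LiuSlade2026_prop12_asymp` of `LaceExpansionIsingDeconvolutionParts.lean`, through
the proved assembly `LiuSlade2026_prop12_asymp_of_parts` and the three discharged inputs.
[cite: LiuSlade2026, Proposition 1.2, (1.9)] -/
theorem LiuSlade2026_prop12_asymp_holds : LiuSlade2026_prop12_asymp :=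
  LiuSlade2026_prop12_asymp_of_parts LiuSlade2026_prop12_fourierRep_holds LiuSlade2026_lem31_fiber_holds
    LiuSlade2026_lem51_L1_holds

end Literature.Barriers.CriticalPhenomena.SpreadOutIsing

end
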